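import Literature.Analysis.FluidPDE.SelfSimilar
import Literature.Analysis.FluidPDE.WholeSpaceIBP
import HarnessLib

/-!
# The localised energy identity of a smooth steady Navier–Stokes solution

Analysis/FluidPDE proof file (everything PROVED, no definitions, no named facts) on the
discharge path of the named fact `Literature.Analysis.FluidPDE.sereginWang_liouville_L3_annulus`
(Seregin–Wang 2020, Thm 1.1 (i), via the Caccioppoli-type inequality of their Prop. 2.1).

Let `(u, p)` be a classical solution of the steady system `−Δu + (u·∇)u + ∇p = 0`, `div u = 0`
on a finite-dimensional real inner product space `E` — the tree's profile class at rate `a = 0`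
and viscosity `ν = 1`, `IsLerayProfile 1 0 u p` (`u ∈ C²`, `p ∈ C¹`) — and let `φ ∈ C²_c(E)`.
Testing the momentum equation against `φ u` and integrating by parts on the whole space (no
boundary terms) gives the **localised energy identity**

  `∫ φ |∇u|² = ½ ∫ (Δφ) |u|² + ½ ∫ (Dφ·u) |u|² + ∫ p (Dφ·u)`
  (`IsLerayProfile.integral_mul_frobeniusNormSq_eq`),

the starting point of every Caccioppoli-type / Saint-Venant estimate for the steady system
(Galdi 2011, proof of Thm X.9.5; Seregin–Wang 2020, proof of Prop. 2.1, display after "integration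
by parts give", here with the test function `φu` instead of `φu − w`; Wang 2025, (2.11)).
Ingredients (tree, `WholeSpaceIBP`): Green's first identity `∫⟪Δv, w⟫ + Σᵢ∫⟪∂ᵢv, ∂ᵢw⟫ = 0`
(twice: for `v = u`, `w = φu`, and for `v = φ`, `w = |u|²`), the trilinear identity
`∫⟪(u·∇)u, φu⟫ + ∫⟪u, (u·∇)(φu)⟫ + ∫ div u ⟪u, φu⟫ = 0`, and `∫⟪∇p, φu⟫ = −∫ p div(φu)`,
with `div(φu) = Dφ·u` for divergence-free `u`.  Also recorded: `∫ Dφ·u = 0`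
(`IsLerayProfile.integral_fderiv_apply_velocity_eq_zero`; the tree's
`integral_fderiv_apply_eq_zero_of_isDivFree` of `TaoEnergyLocalisationProofs`, re-derived to keep
the import closure small), by which the pressure may be shifted by any constant.

## References

* G. Seregin, W. Wang, St. Petersburg Math. J. 31 (2020) = arXiv:1805.02227, proof of Prop. 2.1.
  [`SereginWang2020`]
* G. P. Galdi, *An introduction to the mathematical theory of the Navier–Stokes equations.
  Steady-state problems*, 2nd ed. (2011), Thm X.9.5 and its proof. [`Galdi2011`]
-/

noncomputable section

open MeasureTheory Set Filter Topology InnerProductSpace Function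
open scoped RealInnerProductSpace Laplacian

namespace Literature.Analysis.FluidPDE

variable {E : Type*} [NormedAddCommGroup E] [InnerProductSpace ℝ E] [FiniteDimensional ℝ E]
  [MeasurableSpace E] [BorelSpace E]

omit [MeasurableSpace E] [BorelSpace E] in
/-- The steady Navier–Stokes equations in the profile class at rate `0`, viscosity `1`:
`Δu = (u·∇)u + ∇p` pointwise. [folklore] -/
theorem IsLerayProfile.laplacian_eq_of_steady {u : E → E} {p : E → ℝ} (h : IsLerayProfile 1 0 u p)
    (x : E) : (Δ u) x = convect u u x + gradient p x := by
  have := h.profile_eq x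
  simp only [one_smul, zero_smul, add_zero] at this
  rw [add_assoc] at this
  exact neg_add_eq_zero.1 this

/-- **The localised energy identity of a smooth steady Navier–Stokes solution.**  For
`IsLerayProfile 1 0 u p` (`−Δu + (u·∇)u + ∇p = 0`, `div u = 0`, `u ∈ C²`, `p ∈ C¹`) and a test
function `φ ∈ C²_c(E)`,
`∫ φ |∇u|² = ½ ∫ (Δφ) |u|² + ½ ∫ (Dφ·u) |u|² + ∫ p (Dφ·u)`, where `|∇u|²` is the Frobenius norm
of `Du` (`frobeniusNormSq`).  (Test the equation with `φu`; Seregin–Wang 2020, proof of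
Prop. 2.1 with `w = 0`; Wang 2025, (2.11).) [cite: SereginWang2020, proof of Prop. 2.1] -/
theorem IsLerayProfile.integral_mul_frobeniusNormSq_eq {u : E → E} {p : E → ℝ}
    (h : IsLerayProfile 1 0 u p) {φ : E → ℝ} (hφ : ContDiff ℝ 2 φ) (hφc : HasCompactSupport φ) :
    ∫ x, φ x * frobeniusNormSq (fderiv ℝ u x) =
      2⁻¹ * (∫ x, (Δ φ) x * ‖u x‖ ^ 2) + 2⁻¹ * (∫ x, fderiv ℝ φ x (u x) * ‖u x‖ ^ 2) +
        ∫ x, p x * fderiv ℝ φ x (u x) := by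
  set b := stdOrthonormalBasis ℝ E with hb
  -- regularity
  have hu2 : ContDiff ℝ 2 u := h.contDiff_velocity
  have hu1 : ContDiff ℝ 1 u := hu2.of_le one_le_two
  have hp1 : ContDiff ℝ 1 p := h.contDiff_pressure
  have hφ1 : ContDiff ℝ 1 φ := hφ.of_le one_le_two
  have hud : ∀ x, DifferentiableAt ℝ u x := fun x => hu1.differentiable one_ne_zero x
  have hφd : ∀ x, DifferentiableAt ℝ φ x := fun x => hφ1.differentiable one_ne_zero x
  have huc : Continuous u := hu1.continuous
  have hDuc : Continuous (fderiv ℝ u) := hu1.continuous_fderiv one_ne_zero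
  have hφcn : Continuous φ := hφ1.continuous
  have hDφc : Continuous (fderiv ℝ φ) := hφ1.continuous_fderiv one_ne_zero
  have hpc : Continuous p := hp1.continuous
  set w : E → E := fun x => φ x • u x with hw
  have hw1 : ContDiff ℝ 1 w := hφ1.smul hu1
  have hwc : HasCompactSupport w := hφc.smul_right
  have hDφcs : HasCompactSupport (fderiv ℝ φ) := hφc.fderiv (𝕜 := ℝ)
  have hΔφcs : HasCompactSupport (Δ φ) := hφc.mono' fun x hx => by
    contrapose! hx; simp [FluidPDE.laplacian_eq_zero_of_notMem_tsupport hx]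
  -- the derivative of `w = φu`
  have hDw : ∀ x v, fderiv ℝ w x v = fderiv ℝ φ x v • u x + φ x • fderiv ℝ u x v := fun x v => by
    rw [hw, fderiv_fun_smul (hφd x) (hud x)]
    simp [add_comm]
  -- (1) the equation tested against `w`
  have heq : ∀ x, ⟪(Δ u) x, w x⟫ = φ x * ⟪convect u u x, u x⟫ + φ x * ⟪gradient p x, u x⟫ := by
    intro x
    rw [h.laplacian_eq_of_steady x, hw]
    simp only [inner_add_left, real_inner_smul_right]
  -- (2) Green's identity for `v = u`, `w = φu`
  have green1 := FluidPDE.integral_inner_laplacian_add_eq_zero b hu2 hw1 (Or.inr hwc)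
  -- the gradient pairing `Σᵢ ⟪∂ᵢu, ∂ᵢ(φu)⟫ = (Σᵢ ∂ᵢφ ⟪∂ᵢu, u⟫) + φ |Du|²`
  have hpair : ∀ x, ∑ i, ⟪fderiv ℝ u x (b i), fderiv ℝ w x (b i)⟫ =
      (∑ i, fderiv ℝ φ x (b i) * ⟪fderiv ℝ u x (b i), u x⟫) +
        φ x * frobeniusNormSq (fderiv ℝ u x) := by
    intro x
    rw [frobeniusNormSq_eq_sum b, Finset.mul_sum, ← Finset.sum_add_distrib]
    refine Finset.sum_congr rfl fun i _ => ?_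
    rw [hDw x (b i), inner_add_right, real_inner_smul_right, real_inner_smul_right,
      real_inner_self_eq_norm_sq]
  -- (3) Green's identity for `v = φ`, `w = |u|²`
  set g : E → ℝ := fun x => ‖u x‖ ^ 2 with hg
  have hg_inner : g = fun x => ⟪u x, u x⟫ := funext fun x => by
    rw [hg, real_inner_self_eq_norm_sq]
  have hg1 : ContDiff ℝ 1 g := by rw [hg_inner]; exact hu1.inner ℝ hu1
  have hDg : ∀ x v, fderiv ℝ g x v = 2 * ⟪fderiv ℝ u x v, u x⟫ := fun x v => by
    rw [hg_inner, fderiv_inner_apply ℝ (hud x) (hud x) v, real_inner_comm]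
    ring
  have green2 := FluidPDE.integral_inner_laplacian_add_eq_zero b (F' := ℝ) hφ hg1 (Or.inl hφc)
  have hg2a : ∫ x, ⟪(Δ φ) x, g x⟫ = ∫ x, (Δ φ) x * ‖u x‖ ^ 2 :=
    integral_congr_ae (Eventually.of_forall fun x => by
      simp only [hg, RCLike.inner_apply, conj_trivial, mul_comm])
  have hg2b : ∀ i, ∫ x, ⟪fderiv ℝ φ x (b i), fderiv ℝ g x (b i)⟫ =
      2 * ∫ x, fderiv ℝ φ x (b i) * ⟪fderiv ℝ u x (b i), u x⟫ := fun i => by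
    rw [← integral_const_mul]
    refine integral_congr_ae (Eventually.of_forall fun x => ?_)
    simp only [RCLike.inner_apply, conj_trivial, hDg]
    ring
  -- (4) the trilinear identity
  have conv := FluidPDE.integral_inner_convect_add_eq_zero (F' := E) hu1 hu1 hw1 hwc
  have hconv3 : ∫ x, VectorCalculus.divergence u x * ⟪u x, w x⟫ = 0 := by
    rw [← integral_zero (α := E) (G := ℝ)]
    refine integral_congr_ae (Eventually.of_forall fun x => ?_)
    show VectorCalculus.divergence u x * ⟪u x, w x⟫ = 0
    rw [h.divFree x, zero_mul]
  have hconv2 : ∀ x, ⟪u x, convect u w x⟫ =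
      φ x * ⟪convect u u x, u x⟫ + fderiv ℝ φ x (u x) * ‖u x‖ ^ 2 := fun x => by
    rw [hw, convect_smul_apply (hφd x) (hud x), inner_add_right, real_inner_smul_right,
      real_inner_smul_right, real_inner_self_eq_norm_sq, real_inner_comm]
  have hconv1 : ∀ x, ⟪convect u u x, w x⟫ = φ x * ⟪convect u u x, u x⟫ := fun x => by
    rw [hw, real_inner_smul_right]
  -- (5) the pressure identity
  have press := FluidPDE.integral_inner_gradient_eq_neg_integral_mul_divergence hp1 hw1 hwc
  have hdivw : ∀ x, VectorCalculus.divergence w x = fderiv ℝ φ x (u x) := fun x => by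
    rw [hw, divergence_smul_apply (hφd x) (hud x), h.divFree x, mul_zero, zero_add, gradient,
      real_inner_comm, InnerProductSpace.toDual_symm_apply]
  have hpress1 : ∀ x, ⟪gradient p x, w x⟫ = φ x * ⟪gradient p x, u x⟫ := fun x => by
    rw [hw, real_inner_smul_right]
  -- integrability of all the integrands (continuous, compactly supported)
  have hcs_φ : ∀ f : E → ℝ, HasCompactSupport fun x => φ x * f x := fun f => hφc.mul_right
  have hI_A : Integrable (fun x => φ x * ⟪convect u u x, u x⟫) :=
    (hφcn.mul ((hDuc.clm_apply huc).inner huc)).integrable_of_hasCompactSupport (hcs_φ _)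
  have hI_P : Integrable (fun x => φ x * ⟪gradient p x, u x⟫) :=
    (hφcn.mul ((continuous_gradient_of_contDiff hp1).inner huc)).integrable_of_hasCompactSupport
      (hcs_φ _)
  have hFc : Continuous fun x => frobeniusNormSq (fderiv ℝ u x) := by
    rw [show (fun x => frobeniusNormSq (fderiv ℝ u x)) =
      fun x => ∑ i, ‖fderiv ℝ u x (b i)‖ ^ 2 from funext fun x => frobeniusNormSq_eq_sum b _]
    exact continuous_finsetSum _ fun i _ => ((hDuc.clm_apply continuous_const).norm).pow 2
  have hI_F : Integrable (fun x => φ x * frobeniusNormSq (fderiv ℝ u x)) :=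
    (hφcn.mul hFc).integrable_of_hasCompactSupport (hcs_φ _)
  have hcs_D : ∀ (v : E → E) (f : E → ℝ),
      HasCompactSupport fun x => fderiv ℝ φ x (v x) * f x := fun v f =>
    hDφcs.mono fun x hx => by
      rw [mem_support] at hx ⊢
      contrapose! hx
      simp [hx]
  have hI_S : ∀ i, Integrable (fun x => fderiv ℝ φ x (b i) * ⟪fderiv ℝ u x (b i), u x⟫) :=
    fun i => (((hDφc.clm_apply continuous_const).mul
      ((hDuc.clm_apply continuous_const).inner huc))).integrable_of_hasCompactSupport
        (hcs_D (fun _ => b i) _)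
  have hI_T : Integrable (fun x => fderiv ℝ φ x (u x) * ‖u x‖ ^ 2) :=
    (((hDφc.clm_apply huc).mul (huc.norm.pow 2))).integrable_of_hasCompactSupport (hcs_D u _)
  -- assemble: rewrite every pairing
  have e1 : ∫ x, ⟪(Δ u) x, w x⟫ = (∫ x, φ x * ⟪convect u u x, u x⟫) +
      ∫ x, φ x * ⟪gradient p x, u x⟫ := by
    rw [← integral_add hI_A hI_P]
    exact integral_congr_ae (Eventually.of_forall heq)
  have e2 : ∑ i, ∫ x, ⟪fderiv ℝ u x (b i), fderiv ℝ w x (b i)⟫ =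
      (∑ i, ∫ x, fderiv ℝ φ x (b i) * ⟪fderiv ℝ u x (b i), u x⟫) +
        ∫ x, φ x * frobeniusNormSq (fderiv ℝ u x) := by
    rw [← integral_finsetSum _ fun i _ => hI_S i, ← integral_add (integrable_finsetSum _
      fun i _ => hI_S i) hI_F]
    have : ∀ i, Integrable (fun x => ⟪fderiv ℝ u x (b i), fderiv ℝ w x (b i)⟫) := fun i => by
      have : (fun x => ⟪fderiv ℝ u x (b i), fderiv ℝ w x (b i)⟫) = fun x =>
          fderiv ℝ φ x (b i) * ⟪fderiv ℝ u x (b i), u x⟫ + φ x * ‖fderiv ℝ u x (b i)‖ ^ 2 := by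
        funext x
        rw [hDw x (b i), inner_add_right, real_inner_smul_right, real_inner_smul_right,
          real_inner_self_eq_norm_sq]
      rw [this]
      exact (hI_S i).add (((hφcn.mul ((hDuc.clm_apply continuous_const).norm.pow 2)))
        |>.integrable_of_hasCompactSupport (hcs_φ _))
    rw [← integral_finsetSum _ fun i _ => this i]
    exact integral_congr_ae (Eventually.of_forall fun x => hpair x)
  have e3 : ∑ i, ∫ x, ⟪fderiv ℝ φ x (b i), fderiv ℝ g x (b i)⟫ =
      2 * ∑ i, ∫ x, fderiv ℝ φ x (b i) * ⟪fderiv ℝ u x (b i), u x⟫ := by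
    rw [Finset.mul_sum]
    exact Finset.sum_congr rfl fun i _ => hg2b i
  have e4 : ∫ x, ⟪u x, convect u w x⟫ = (∫ x, φ x * ⟪convect u u x, u x⟫) +
      ∫ x, fderiv ℝ φ x (u x) * ‖u x‖ ^ 2 := by
    rw [← integral_add hI_A hI_T]
    exact integral_congr_ae (Eventually.of_forall hconv2)
  have e5 : ∫ x, ⟪convect u u x, w x⟫ = ∫ x, φ x * ⟪convect u u x, u x⟫ :=
    integral_congr_ae (Eventually.of_forall hconv1)
  have e6 : ∫ x, ⟪gradient p x, w x⟫ = ∫ x, φ x * ⟪gradient p x, u x⟫ :=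
    integral_congr_ae (Eventually.of_forall hpress1)
  have e7 : ∫ x, p x * VectorCalculus.divergence w x = ∫ x, p x * fderiv ℝ φ x (u x) :=
    integral_congr_ae (Eventually.of_forall fun x => by
      show p x * VectorCalculus.divergence w x = p x * fderiv ℝ φ x (u x)
      rw [hdivw x])
  rw [e1, e2] at green1
  rw [hg2a, e3] at green2
  rw [e5, e4, hconv3] at conv
  rw [e6, e7] at press
  linarith

/-- `∫ Dφ·u = 0` for the velocity of a steady solution and `φ ∈ C¹_c`: the pressure in the
localised energy identity may be replaced by `p − c` for any constant `c`. [folklore] -/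
theorem IsLerayProfile.integral_fderiv_apply_velocity_eq_zero {u : E → E} {p : E → ℝ}
    (h : IsLerayProfile 1 0 u p) {φ : E → ℝ} (hφ : ContDiff ℝ 1 φ) (hφc : HasCompactSupport φ) :
    ∫ x, fderiv ℝ φ x (u x) = 0 := by
  -- (the same computation as `integral_fderiv_apply_eq_zero_of_isDivFree` of
  -- `TaoEnergyLocalisationProofs`, not imported here to keep the import closure small)
  have hu : ContDiff ℝ 1 u := h.contDiff_velocity.of_le one_le_two
  have h1 := integral_mul_divergence_add_eq_zero_left hφ hu hφc
  have h0 : ∫ x, φ x * VectorCalculus.divergence u x = 0 := by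
    rw [← integral_zero (α := E) (G := ℝ)]
    refine integral_congr_ae (Eventually.of_forall fun x => ?_)
    show φ x * VectorCalculus.divergence u x = 0
    rw [h.divFree x, mul_zero]
  rw [h0, zero_add] at h1
  rw [← h1]
  refine integral_congr_ae (Eventually.of_forall fun x => ?_)
  show fderiv ℝ φ x (u x) = ⟪u x, gradient φ x⟫
  rw [real_inner_comm, inner_gradient_left]

end Literature.Analysis.FluidPDE

end
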